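import Summits.QuantumFields.BalabanUV.T4Continuum.Support.NE9CurChartOneInstanceUniformBall
import Literature.MathematicalPhysics.QuantumFieldTheory.Balaban1983to89.B9Eq335SmallBondsData

/-!
# NE9CurChartOneInstanceSmallBonds — THE ONE-INSTANCE CHART OF `cur U` ON ONE PAIR OF BALLS FOR EVERY UNIT-BOUNDED SMALL-BOND BACKGROUND OF A
# FIXED LATTICE: (A″) `Support/NE9CurChartOneInstanceUniformBall.cur_chart_exists_oneInstance_smallField_uniform_smallJ` (this lineage, gen 68) with
# E162's FIVE structural background binders (`hα`, `hα1`, `hU1`, `hreg`, `hαL`) PRODUCED from ONE smallness number by the owner's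
# `B9Eq335SmallBondsData` (gen 82); cell `pub-balaban`, T4-DAG §2 node U3 ∕ §6 NE9, route R2′ of `t4/ROUTES-NE9.md`; NE9 crux-team leaf lineage
# `b2b-balaban-t4-ne9-formalise-leaf-05`, generation 69; Summits-side NEW leaf under this seat's INTERFACE REQUEST NE9 (ruling e34b3e0c (0): «no new
# leaves unless a CRUX prover requests a specific NAMED interface» — requested: `NE9CurChartOneInstanceSmallBonds.cur_chart_exists_oneInstance_smallJ_of_small_bonds`
# (+ `_unitary`); a separate file because the host leaf (A″) (387 l.) would exceed the 400-line rule — the owner's (S′) v1.2 precedent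
# `NE9CurChartUniformBall.cur_chart_exists_of_small_bonds` for the END's `Λ := 0` face), nothing printed asserted

HONEST FRAMING (T4-DAG PAGE 1).  Rung (B)+1 of the FINITE-VOLUME T⁴ programme — NOT infinite volume, NOT a mass gap, NOT the Clay problem.  NE9
(`T4OutputRate.NE9` ∧ `FadingMemory`) is a cell NEW ESTIMATE, NOT PRINTED in [I] = [Balaban1987RG1] (CMP **109**), [II] = [Balaban1988RG2Cluster]
(CMP **116**), and NOT PROVED here («NE9 ⇐ the named binders»; spine PROVED 0∕9).  HONEST DEPENDENCY (cell line, verbatim): continuum YM on T⁴ ⇐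
BetaPertH ∧ nine spine estimates (0/9 proved); BetaPertH ⇐ (D1) ∧ (D4) ∧ CAP+tail; G-an2-4 gates asym, D1 and NE2/3/4.  The `cur U` OBJECT is ONE
item of the MODEL O-NE9-1 (species (a) data); the END's `act` ∕ `ker` halves and NEEDS-COORDINATOR #5 are untouched.

WHY.  In (A″) §3 the background `U` of the fixed lattice `T_{L·m}` enters through E162's (`B9Eq315QTorus`) five STRUCTURAL binders — `hU1`
(unit-bounded periodic extension), `hreg : ‖W_{c,x}(Ũ) − 1‖ ≤ α` (α-regular block loops), `hα : α ≤ 1∕128`, `hα1 : α ≤ 1∕64`,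
`hαL : 50(d+1)αL^d ≤ ½` — plus the smallness `‖U(b) − 1‖ ≤ ε ≤ ε₃` and `hRS`.  The owner's `B9Eq335SmallBondsData` (gen 82) reads the five off the
smallness: a block loop of `≤ 2(d+1)L` unit-bounded bonds `ε`-close to `1` is `2(d+1)Lε`-close to `1` (NE9 leaf-04's `B9Eq315QLipschitz.norm_Wcx_sub_one_le`,
[Balaban1985Averaging] (42) p. 23), and the three scalar conditions hold once `ε ≤ ε_reg(d, L) = 1∕(256(d+1)²L^{d+1})`.  This file is the
ONE-INSTANCE-FACE twin of the owner's (S′) v1.2 `cur_chart_exists_of_small_bonds` (the END's `Λ := 0` face): T23's species of the (174)∘(47) chart of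
`cur U` (W80 at the T-slot's own `ε_C`, the J-79 term in the linear slot `Λ := −(𝔊(U) ∘L L_J)`) on ONE pair of balls, for every background displayed
through {`U(b) ∈ U1`, `‖U(b) − 1‖ ≤ ε ≤ ε₃`, `hRS`} ONLY — the instancer's datum for Bałaban's `U_k` in a small gauge ([Balaban1987RG1] (1.11)–(1.14)
p. 262; [Balaban1985BackgroundPropagators] (3.35)–(3.36) p. 396, loci only) — and, in §2, with `hRS` discharged by the model letters (unitary bond variables,
tracial `τ`, `⟨φ⁻¹X, φ⁻¹Y⟩ = τ(X*Y)`; the owner's `B9Thm311SmallFieldClosed.hRS_of_unitary`).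

WHAT THIS FILE PROVES (TWO theorems; 0 def, 0 sorry, axioms standard).  §1 **`cur_chart_exists_oneInstance_smallJ_of_small_bonds`**: given the
fibre∕trace letters, `0 < a`, the fixed (L3) operators `ρ`, `τc`, V₀-slot letters `C_V ≥ 0`, `R_V > 0` and current bounds `M_J > 0`, `M_Δ ≥ 0`, there
are `ε₃ > 0` WITH `ε₃ ≤ ε_reg(d, L)`, T-slot radii `a_C, ε_C > 0`, W-slot letters `a₃ > 0`, `C₄ ≥ 0`, chart radii `ε₄, R_b, R′ > 0` and a current
threshold `0 < j₁ ≤ M_J` — ALL BEFORE `∀ U` — such that for EVERY `U` with `U(b) ∈ U1`, `‖U(b) − 1‖ ≤ ε ≤ ε₃` (and `ε ≤ ε_reg(d, L)`, implied, kept as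
a binder because the structural proofs are terms of the statement), `hRS`, the V₀-group's slot at `(C_V, R_V)`, and ALL currents with `‖J‖₍₋₃₎ ≤ j₁`,
`‖Δπ‖ ≤ M_Δ`: `hpos(U)` HOLDS (for `Δ_a(U)` = `laplaceAofBackground` AT THE PRODUCED structural proofs `alpha_le_64 ∕ perCfg_mem_U1 ∕
hreg_of_small_bonds`), the W-slot obeys (98) at `(C₄, a₃)`, `‖𝔊(U) ∘L L_J‖ ≤ ½`, and the one-instance chart `chartHB 𝔊(U) (−(𝔊(U) ∘L L_J))
(W80 ρ τc U H(U) C(U) ε_C J Δπ) 0 (A′ ↦ A′ + solA H(U) 0 C(U) 0 ε_C A′) ε₄ H(U)` — `H(U)`, `𝔊(U)` read through `QtorusW_surjective` AT THE PRODUCED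
proofs (`alphaL_le_half` for `hαL`) — satisfies (Ψ1)–(Ψ3) on `ball 0 R_b → ball 0 R′`.  §2 **`…_of_small_bonds_unitary`**: the same with `hRS`
replaced by `U(b)* = U(b)⁻¹` and the two model letters `hτφ`, `htr`.  By proof irrelevance the operators are the SAME terms as (A″)'s at any other
admissible structural proofs, so (B″) §4 ∕ (C″) ∕ (C′) §1 consume §1–§2 unchanged.
MECHANISM: (A″) §3 at `α := 2(d+1)Lε` with `hα hα1 hU1 hreg hαL := alpha_le_128, alpha_le_64, perCfg_mem_U1, hreg_of_small_bonds, alphaL_le_half`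
and `ε₃ := min ε₃(A″) ε_reg(d, L)`; §2 = §1 ∘ `hRS_of_unitary`.  Ten proof lines in all.
DISGUISE TEST: composition of landed theorems; no inequality of the series proved; every number a per-LATTICE number (`ε_reg`, `ε₃`, radii,
thresholds depend on `d, L, m, η, c₀, c₁, a, M_φ, M_φ′, C_τ, ρ, τc, C_V, R_V, M_J, M_Δ`) — NOT print's regularity class (3.35)–(3.36) p. 396 (read
first-hand: on each cube of the class a gauge `u` with `Uᵘ = e^{iηA}`, `|A| < O(1)Mα₀(Lʲη)⁻¹`, `|∇A| < O(1)Mα₀(Lʲη)⁻²`, and (3.36) a bound on `∇*∇A` — a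
LOCAL-GAUGE condition with a uniform `α₀`), NOT [Balaban1987RG1] (1.11)–(1.12) p. 262 (plaquettes `|∂U − 1| < α₀ξ²` AND such a gauge on cubes): the
hypothesis here is bond-wise smallness `‖U(b) − 1‖ ≤ ε` in the GIVEN gauge on the whole torus, with a per-lattice threshold; NOT print's uniformity in the
LATTICE ([Balaban1985BackgroundPropagators] Thms 3.12∕3.13), NOT (73)∕(97)'s «d and L only», NOT (28) as printed; the Λ-road is ONE of T23's two
admissible placements — the chain's road stays the OWNER's decision; not NE9.
References (TYPES ∕ loci only): [Balaban1985Variational] (28) p. 282, (45)–(47) p. 285, (79)–(80) p. 290, Prop. 4 (97)–(98) pp. 292–293, Prop. 6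
(117)–(121) p. 295, (172)–(175) p. 305; [Balaban1985BackgroundPropagators] (3.5) p. 391, (3.35)–(3.36) p. 396, Thm 3.11 p. 416, (3.126) p. 420,
(3.153) p. 426; [Balaban1985Averaging] (42) p. 23, Prop. 3 (121)–(126) p. 36; [Balaban1987RG1] (1.11)–(1.14) p. 262.
Imports (A″) `Support/NE9CurChartOneInstanceUniformBall` (this lineage gen 68) and the owner's `B9Eq335SmallBondsData` (gen 82) ONLY; modifies
nothing; no END re-wired.  Value = route R2′ bookkeeping at rung (B)+1 (the one-instance face stated with ONE background smallness number), NOT summit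
progress.
-/

noncomputable section

open Metric Set
open scoped InnerProductSpace

namespace Summit.QuantumFields.BalabanUV.T4Continuum.NE9CurChartOneInstanceSmallBonds

open Literature.MathematicalPhysics.QuantumFieldTheory.Balaban1983to89
open B11Eq103H1Complex B11Eq115Space B11Eq174Chart
open B11Eq111FrakG (nabla115)
open B13Contraction113 (QuadAnalytic)
open B9Eq319QprimeTorus (fineP)
open B9SectCLatticeCarrier (Bond)
open B7Prop1Explicit (U1)
open B9Eq315QTorus (laplaceAofBackground)
open B9Eq315QTorusOnto (QtorusW_surjective)
open B9Eq310HessianOperator (adTransportW)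
open B9Eq335SmallBondsData (perCfg_mem_U1 hreg_of_small_bonds alpha_le_128 alpha_le_64 alphaL_le_half epsReg_pos)
open B9Thm311SmallFieldClosed (hRS_of_unitary)
open B11Eq44COperatorTorus (Cc)
open B11Eq80Current (W80)
open B11Eq79LinearTerm (LJ)
open B11Eq63V0GroupCurrent (curV0)
open Summit.QuantumFields.BalabanUV.T4Continuum.NE9CurChartOneInstanceUniformBall (cur_chart_exists_oneInstance_smallField_uniform_smallJ)

/-! ## §1 The one-instance chart on one pair of balls, background binders {`U1`, small bonds, `hRS`} only -/

set_option maxRecDepth 8192 in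
/-- **THE ONE-INSTANCE CHART OF `cur U` ON ONE PAIR OF BALLS FOR EVERY UNIT-BOUNDED SMALL-BOND BACKGROUND OF A FIXED LATTICE AND ALL SMALL
CURRENTS** — (A″) §3 `cur_chart_exists_oneInstance_smallField_uniform_smallJ` with E162's five structural binders PRODUCED (`B9Eq335SmallBondsData`:
`hα`∕`hα1` = `alpha_le_128`∕`alpha_le_64`, `hU1` = `perCfg_mem_U1`, `hreg` = `hreg_of_small_bonds`, `hαL` = `alphaL_le_half`, at `α := 2(d+1)Lε`):
there are `ε₃ > 0` with `ε₃ ≤ ε_reg(d, L) = 1∕(256(d+1)²L^{d+1})`, T-slot radii `a_C, ε_C`, W-slot letters `(a₃, C₄)`, chart radii `ε₄, R_b, R′` and a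
current threshold `0 < j₁ ≤ M_J` — all BEFORE `∀ U` — such that for EVERY background `U` with `U(b) ∈ U1`, `‖U(b) − 1‖ ≤ ε ≤ ε₃` (and `ε ≤ ε_reg(d, L)`)
and `hRS`, the V₀-slot at `(C_V, R_V)`, all currents `‖J‖ ≤ j₁`, `‖Δπ‖ ≤ M_Δ`: `hpos(U)` HOLDS, `QuadAnalytic (W80 …) C₄ a₃`, `‖𝔊(U) ∘L L_J‖ ≤ ½`, and
lit-balaban's one-instance chart (174)∘(47) of `cur U` satisfies (Ψ1)–(Ψ3) on `ball 0 R_b → ball 0 R′`.  NOT print's uniformity in the lattice; NOT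
print's local-gauge regularity class (3.35)–(3.36) ∕ [I] (1.11)–(1.12) — bond-wise smallness in the given gauge, per-lattice threshold. [folklore] -/
theorem cur_chart_exists_oneInstance_smallJ_of_small_bonds {d : ℕ} (L : ℕ) [NeZero L] (m : Fin d → ℕ) [∀ i, NeZero (fineP L m i)]
    (hL : 1 ≤ L)
    {𝔸 : Type*} [NormedRing 𝔸] [NormedAlgebra ℂ 𝔸] [CompleteSpace 𝔸] [NormOneClass 𝔸] [StarRing 𝔸] [NormedStarGroup 𝔸] [StarModule ℂ 𝔸]
    [FiniteDimensional ℂ 𝔸]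
    {W : Type*} [NormedAddCommGroup W] [InnerProductSpace ℂ W] [FiniteDimensional ℂ W] (φ : W ≃ₗ[ℂ] 𝔸) {Mφ Mφ' : ℝ} (hMφ : 0 ≤ Mφ)
    (hMφ' : 0 ≤ Mφ') (hφ : ∀ w, ‖φ w‖ ≤ Mφ * ‖w‖) (hφ' : ∀ X, ‖φ.symm X‖ ≤ Mφ' * ‖X‖)
    (τ : 𝔸 →ₗ[ℂ] ℂ) {Cτ : ℝ} (hτ : ∀ X, ‖τ X‖ ≤ Cτ * ‖X‖) (hCτ : 0 ≤ Cτ)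
    {η : ℝ} [Fact (0 < (L : ℝ))] [Fact (0 < η)] {lev₀ : Bond d (fineP L m) → ℕ} {levB : Bond d m → ℕ} (lev₁ : Bond d (fineP L m) × Fin d → ℕ)
    (hlev : ∀ b, 1 ≤ lev₀ b) {c₀ c₁ : ℝ} [Fact (0 < c₀)] [Fact (0 < c₁)] {a : ℝ} (ha : 0 < a)
    (ρ : (𝔸 →L[ℂ] ℂ) →L[ℂ] 𝔸) (τc : 𝔸 →L[ℂ] ℂ) {CV RV MJ MΔ : ℝ} (hCV : 0 ≤ CV) (hRV : 0 < RV) (hMJ : 0 < MJ) (hMΔ : 0 ≤ MΔ) :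
    ∃ ε₃ aC εC a₃ C₄ ε₄ Rb R' j₁ : ℝ, 0 < ε₃ ∧ ε₃ ≤ 1 / (256 * ((d : ℝ) + 1) ^ 2 * (L : ℝ) ^ (d + 1)) ∧
      0 < aC ∧ 0 < εC ∧ 0 < a₃ ∧ 0 ≤ C₄ ∧ 0 < ε₄ ∧ 0 < Rb ∧ 0 < R' ∧ 0 < j₁ ∧ j₁ ≤ MJ ∧
      ∀ (U : Bond d (fineP L m) → 𝔸ˣ) (hU : ∀ b, U b ∈ U1 𝔸) {ε : ℝ} (hε : 0 ≤ ε)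
        (hεr : ε ≤ 1 / (256 * ((d : ℝ) + 1) ^ 2 * (L : ℝ) ^ (d + 1))), ε ≤ ε₃ → ∀ (hUε : ∀ b, ‖(U b : 𝔸) - 1‖ ≤ ε),
        (∀ (b : Bond d (fineP L m)) (v u : W), inner ℂ (adTransportW φ U b v) u = inner ℂ v (adTransportW φ (fun b => (U b)⁻¹) b u)) →
        (∀ Y : Space115 (L : ℝ) η lev₀ lev₁ (nabla115 η U), ‖Y‖ < RV →
          ‖curV0 (lev₁ := lev₁) (Dc := nabla115 η U) ρ τc U Y‖ ≤ CV * ‖Y‖ ^ 2) →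
      ∀ (J : NegSize (L : ℝ) η lev₀ 3 𝔸) (Δπ : Space115 (L : ℝ) η lev₀ lev₁ (nabla115 η U) →L[ℂ] NegSize (L : ℝ) η lev₀ 3 𝔸),
        ‖J‖ ≤ j₁ → ‖Δπ‖ ≤ MΔ →
      ∃ hpos : ∀ x : BondL2K ℂ d (fineP L m) c₀ W, x ≠ 0 →
          0 < RCLike.re (inner ℂ x (laplaceAofBackground L m hL φ U (alpha_le_64 hL hε hεr) (perCfg_mem_U1 L m hU)
            (hreg_of_small_bonds L m hU hε hUε) τ η (c₀ := c₀) (c₁ := c₁) a x)),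
      let Hc := H1LatticeCLM (lev₀ := lev₀) (levB := levB) φ hpos (QtorusW_surjective L m hL U (alpha_le_64 hL hε hεr) (perCfg_mem_U1 L m hU)
        (hreg_of_small_bonds L m hU hε hUε) (alphaL_le_half hL hεr) φ) lev₁ (nabla115 η U)
      let Gc := frakGLatticeCLM (lev₀ := lev₀) φ hpos (QtorusW_surjective L m hL U (alpha_le_64 hL hε hεr) (perCfg_mem_U1 L m hU)
        (hreg_of_small_bonds L m hU hε hUε) (alphaL_le_half hL hεr) φ) lev₁ (nabla115 η U)
      let Cx := Cc L m η U lev₀ lev₁ (nabla115 η U) levB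
      QuadAnalytic (W80 ρ τc U Hc Cx εC J Δπ) C₄ a₃ ∧ ‖Gc.comp (LJ ρ τc Hc Cx J)‖ ≤ 1 / 2 ∧
      DifferentiableOn ℂ (chartHB Gc (-(Gc.comp (LJ ρ τc Hc Cx J))) (W80 ρ τc U Hc Cx εC J Δπ) 0
          (fun A' => A' + solA Hc 0 Cx 0 εC A') ε₄ Hc) (ball (0 : NegSize (L : ℝ) η levB 0 𝔸) Rb) ∧
      MapsTo (chartHB Gc (-(Gc.comp (LJ ρ τc Hc Cx J))) (W80 ρ τc U Hc Cx εC J Δπ) 0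
          (fun A' => A' + solA Hc 0 Cx 0 εC A') ε₄ Hc) (ball (0 : NegSize (L : ℝ) η levB 0 𝔸) Rb)
          (ball (0 : Space115 (L : ℝ) η lev₀ lev₁ (nabla115 η U)) R') ∧
      chartHB Gc (-(Gc.comp (LJ ρ τc Hc Cx J))) (W80 ρ τc U Hc Cx εC J Δπ) 0
          (fun A' => A' + solA Hc 0 Cx 0 εC A') ε₄ Hc 0 = 0 := by
  obtain ⟨ε₃, aC, εC, a₃, C₄, ε₄, Rb, R', j₁, hε₃, haC, hεC, ha₃, hC₄, hε₄, hRb, hR', hj₁, hj₁M, H⟩ :=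
    cur_chart_exists_oneInstance_smallField_uniform_smallJ L m hL φ hMφ hMφ' hφ hφ' τ hτ hCτ (η := η) (lev₀ := lev₀) (levB := levB) lev₁ hlev
      (c₀ := c₀) (c₁ := c₁) ha ρ τc hCV hRV hMJ hMΔ
  refine ⟨min ε₃ (1 / (256 * ((d : ℝ) + 1) ^ 2 * (L : ℝ) ^ (d + 1))), aC, εC, a₃, C₄, ε₄, Rb, R', j₁, lt_min hε₃ (epsReg_pos hL),
    min_le_right _ _, haC, hεC, ha₃, hC₄, hε₄, hRb, hR', hj₁, hj₁M, ?_⟩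
  intro U hU ε hε hεr hεm hUε hRS hqV J Δπ hJ hΔ
  exact H U (alpha_le_128 hL hε hεr) (alpha_le_64 hL hε hεr) (perCfg_mem_U1 L m hU) (hreg_of_small_bonds L m hU hε hUε)
    (alphaL_le_half hL hεr) hε (hεm.trans (min_le_left _ _)) hUε hRS hqV J Δπ hJ hΔ

/-! ## §2 The same with `hRS` discharged by the model letters (unitary bond variables, tracial `τ`) -/

set_option maxRecDepth 8192 in
/-- **THE SAME WITH `hRS` DISCHARGED BY THE MODEL LETTERS** (`B9Thm311SmallFieldClosed.hRS_of_unitary`): for unitary bond variables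
(`U(b)* = U(b)⁻¹`), a tracial `τ` and the norming `⟨φ⁻¹X, φ⁻¹Y⟩ = τ(X*Y)`, the one-instance chart of `cur U` satisfies (Ψ1)–(Ψ3) on ONE pair of balls for
EVERY unit-bounded unitary small-bond background of a fixed lattice and all small currents — background binders {`U(b) ∈ U1`, `U(b)` unitary,
`‖U(b) − 1‖ ≤ ε ≤ ε₃`} and nothing else (+ the fibre∕trace letters, the fixed (L3) operators `ρ`, `τc`, the V₀-slot at `(C_V, R_V)`). [folklore] -/
theorem cur_chart_exists_oneInstance_smallJ_of_small_bonds_unitary {d : ℕ} (L : ℕ) [NeZero L] (m : Fin d → ℕ) [∀ i, NeZero (fineP L m i)]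
    (hL : 1 ≤ L)
    {𝔸 : Type*} [NormedRing 𝔸] [NormedAlgebra ℂ 𝔸] [CompleteSpace 𝔸] [NormOneClass 𝔸] [StarRing 𝔸] [NormedStarGroup 𝔸] [StarModule ℂ 𝔸]
    [FiniteDimensional ℂ 𝔸]
    {W : Type*} [NormedAddCommGroup W] [InnerProductSpace ℂ W] [FiniteDimensional ℂ W] (φ : W ≃ₗ[ℂ] 𝔸) {Mφ Mφ' : ℝ} (hMφ : 0 ≤ Mφ)
    (hMφ' : 0 ≤ Mφ') (hφ : ∀ w, ‖φ w‖ ≤ Mφ * ‖w‖) (hφ' : ∀ X, ‖φ.symm X‖ ≤ Mφ' * ‖X‖)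
    (τ : 𝔸 →ₗ[ℂ] ℂ) {Cτ : ℝ} (hτ : ∀ X, ‖τ X‖ ≤ Cτ * ‖X‖) (hCτ : 0 ≤ Cτ)
    (hτφ : ∀ X Y : 𝔸, inner ℂ (φ.symm X) (φ.symm Y) = τ (star X * Y)) (htr : ∀ X Y : 𝔸, τ (X * Y) = τ (Y * X))
    {η : ℝ} [Fact (0 < (L : ℝ))] [Fact (0 < η)] {lev₀ : Bond d (fineP L m) → ℕ} {levB : Bond d m → ℕ} (lev₁ : Bond d (fineP L m) × Fin d → ℕ)
    (hlev : ∀ b, 1 ≤ lev₀ b) {c₀ c₁ : ℝ} [Fact (0 < c₀)] [Fact (0 < c₁)] {a : ℝ} (ha : 0 < a)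
    (ρ : (𝔸 →L[ℂ] ℂ) →L[ℂ] 𝔸) (τc : 𝔸 →L[ℂ] ℂ) {CV RV MJ MΔ : ℝ} (hCV : 0 ≤ CV) (hRV : 0 < RV) (hMJ : 0 < MJ) (hMΔ : 0 ≤ MΔ) :
    ∃ ε₃ aC εC a₃ C₄ ε₄ Rb R' j₁ : ℝ, 0 < ε₃ ∧ ε₃ ≤ 1 / (256 * ((d : ℝ) + 1) ^ 2 * (L : ℝ) ^ (d + 1)) ∧
      0 < aC ∧ 0 < εC ∧ 0 < a₃ ∧ 0 ≤ C₄ ∧ 0 < ε₄ ∧ 0 < Rb ∧ 0 < R' ∧ 0 < j₁ ∧ j₁ ≤ MJ ∧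
      ∀ (U : Bond d (fineP L m) → 𝔸ˣ) (hU : ∀ b, U b ∈ U1 𝔸) {ε : ℝ} (hε : 0 ≤ ε)
        (hεr : ε ≤ 1 / (256 * ((d : ℝ) + 1) ^ 2 * (L : ℝ) ^ (d + 1))), ε ≤ ε₃ → ∀ (hUε : ∀ b, ‖(U b : 𝔸) - 1‖ ≤ ε),
        (∀ b, star (U b : 𝔸) = (((U b)⁻¹ : 𝔸ˣ) : 𝔸)) →
        (∀ Y : Space115 (L : ℝ) η lev₀ lev₁ (nabla115 η U), ‖Y‖ < RV →
          ‖curV0 (lev₁ := lev₁) (Dc := nabla115 η U) ρ τc U Y‖ ≤ CV * ‖Y‖ ^ 2) →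
      ∀ (J : NegSize (L : ℝ) η lev₀ 3 𝔸) (Δπ : Space115 (L : ℝ) η lev₀ lev₁ (nabla115 η U) →L[ℂ] NegSize (L : ℝ) η lev₀ 3 𝔸),
        ‖J‖ ≤ j₁ → ‖Δπ‖ ≤ MΔ →
      ∃ hpos : ∀ x : BondL2K ℂ d (fineP L m) c₀ W, x ≠ 0 →
          0 < RCLike.re (inner ℂ x (laplaceAofBackground L m hL φ U (alpha_le_64 hL hε hεr) (perCfg_mem_U1 L m hU)
            (hreg_of_small_bonds L m hU hε hUε) τ η (c₀ := c₀) (c₁ := c₁) a x)),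
      let Hc := H1LatticeCLM (lev₀ := lev₀) (levB := levB) φ hpos (QtorusW_surjective L m hL U (alpha_le_64 hL hε hεr) (perCfg_mem_U1 L m hU)
        (hreg_of_small_bonds L m hU hε hUε) (alphaL_le_half hL hεr) φ) lev₁ (nabla115 η U)
      let Gc := frakGLatticeCLM (lev₀ := lev₀) φ hpos (QtorusW_surjective L m hL U (alpha_le_64 hL hε hεr) (perCfg_mem_U1 L m hU)
        (hreg_of_small_bonds L m hU hε hUε) (alphaL_le_half hL hεr) φ) lev₁ (nabla115 η U)
      let Cx := Cc L m η U lev₀ lev₁ (nabla115 η U) levB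
      QuadAnalytic (W80 ρ τc U Hc Cx εC J Δπ) C₄ a₃ ∧ ‖Gc.comp (LJ ρ τc Hc Cx J)‖ ≤ 1 / 2 ∧
      DifferentiableOn ℂ (chartHB Gc (-(Gc.comp (LJ ρ τc Hc Cx J))) (W80 ρ τc U Hc Cx εC J Δπ) 0
          (fun A' => A' + solA Hc 0 Cx 0 εC A') ε₄ Hc) (ball (0 : NegSize (L : ℝ) η levB 0 𝔸) Rb) ∧
      MapsTo (chartHB Gc (-(Gc.comp (LJ ρ τc Hc Cx J))) (W80 ρ τc U Hc Cx εC J Δπ) 0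
          (fun A' => A' + solA Hc 0 Cx 0 εC A') ε₄ Hc) (ball (0 : NegSize (L : ℝ) η levB 0 𝔸) Rb)
          (ball (0 : Space115 (L : ℝ) η lev₀ lev₁ (nabla115 η U)) R') ∧
      chartHB Gc (-(Gc.comp (LJ ρ τc Hc Cx J))) (W80 ρ τc U Hc Cx εC J Δπ) 0
          (fun A' => A' + solA Hc 0 Cx 0 εC A') ε₄ Hc 0 = 0 := by
  obtain ⟨ε₃, aC, εC, a₃, C₄, ε₄, Rb, R', j₁, hε₃, hle, haC, hεC, ha₃, hC₄, hε₄, hRb, hR', hj₁, hj₁M, H⟩ :=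
    cur_chart_exists_oneInstance_smallJ_of_small_bonds L m hL φ hMφ hMφ' hφ hφ' τ hτ hCτ (η := η) (lev₀ := lev₀) (levB := levB) lev₁ hlev
      (c₀ := c₀) (c₁ := c₁) ha ρ τc hCV hRV hMJ hMΔ
  refine ⟨ε₃, aC, εC, a₃, C₄, ε₄, Rb, R', j₁, hε₃, hle, haC, hεC, ha₃, hC₄, hε₄, hRb, hR', hj₁, hj₁M, ?_⟩
  intro U hU ε hε hεr hεm hUε hUstar hqV J Δπ hJ hΔ
  exact H U hU hε hεr hεm hUε (hRS_of_unitary φ τ hτφ htr U hUstar) hqV J Δπ hJ hΔ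

end Summit.QuantumFields.BalabanUV.T4Continuum.NE9CurChartOneInstanceSmallBonds

end
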